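import Literature.Geometry.Lorentzian.ModelDataProofs
import HarnessLib

/-!
# The spatial projection of a spacelike immersion into Minkowski space-time is an expanding
# immersion

For a spacelike immersion `f : N → (ℝ⁴, η)` the spatial projection `π ∘ f : N → ℝ³`
(`E4.spatial`) does not decrease lengths: `(f^*η)(v, v) = ‖π(df v)‖² − (dt(df v))² ≤ ‖π(df v)‖²`.
Hence `d(π ∘ f)` is injective and `π ∘ f` is an immersion of `N` into `ℝ³` which is *expanding*
for the induced metric — the property of "the map `Φ`" in the last step of the proof of the rigid
positive energy theorem (Beig–Chruściel, J. Math. Phys. 37 (1996), §4: `Φ : Σ̃ → ℝ³` is a local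
diffeomorphism with `|X|_δ ≥ |X|_g`, hence, `(Σ, g)` being complete, a covering [C3, Lemma 1 and
Thm. 1]; do Carmo 1992, Ch. 7, Lemma 3.3).

* `Minkowski.bilin_eq_neg_time_mul_add_inner_spatial`, `Minkowski.bilin_self_eq_norm_spatial_sq_sub`
  — `η(x, x') = −x⁰x'⁰ + ⟪π x, π x'⟫`, `η(x, x) = ‖π x‖² − (x⁰)²`;
* `Minkowski.inducedBilin_self_le_norm_spatial_sq` — `(f^*η)_y(v, v) ≤ ‖π(df_y v)‖²`;
* `Minkowski.injective_spatial_comp_mfderiv` — for a spacelike immersion, `π ∘ df_y` is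
  injective (so `π ∘ f` is an immersion when `dim N = 3`).

Theorems only; no definitions, no named facts.

## References

* R. Beig, P. T. Chruściel, J. Math. Phys. 37 (1996) 1939–1961, §4 (proof of Thm. 4.1).
* M. P. do Carmo, *Riemannian Geometry*, Birkhäuser 1992, Ch. 7, Lemma 3.3.
* B. O'Neill, *Semi-Riemannian geometry*, 1983, Ch. 3, p. 55.
-/

noncomputable section

open Bundle Set Function Manifold
open scoped Manifold ContDiff Topology RealInnerProductSpace

namespace Literature.Geometry.Lorentzian

namespace Minkowski

variable {E' : Type*} [NormedAddCommGroup E'] [NormedSpace ℝ E'] {H' : Type*} [TopologicalSpace H']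
  {I' : ModelWithCorners ℝ E' H'} {N : Type*} [TopologicalSpace N] [ChartedSpace H' N]

/-- `η(x, x') = −x⁰ x'⁰ + ⟪π x, π x'⟫` in the time/space splitting `x = (x⁰, π x)`.
[cite: ONeill1983, Ch. 3, p. 55] -/
theorem bilin_eq_neg_time_mul_add_inner_spatial (x x' : E4) :
    bilin x x' = -(E4.time x * E4.time x') + ⟪E4.spatial x, E4.spatial x'⟫ := by
  conv_lhs => rw [← E4.ofTimeSpace_time_spatial x, ← E4.ofTimeSpace_time_spatial x']
  rw [bilin_apply]
  simp only [E4.ofTimeSpace_apply_zero, E4.ofTimeSpace_apply_succ, PiLp.inner_apply,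
    RCLike.inner_apply, conj_trivial]
  congr 1
  exact Finset.sum_congr rfl fun i _ ↦ mul_comm _ _

/-- `η(x, x) = ‖π x‖² − (x⁰)²`. [cite: ONeill1983, Ch. 3, p. 55] -/
theorem bilin_self_eq_norm_spatial_sq_sub (x : E4) :
    bilin x x = ‖E4.spatial x‖ ^ 2 - E4.time x ^ 2 := by
  rw [bilin_eq_neg_time_mul_add_inner_spatial, real_inner_self_eq_norm_sq]
  ring

/-- **The spatial projection of a map into Minkowski space-time does not decrease induced
lengths**: `(f^*η)_y(v, v) ≤ ‖π(df_y v)‖²` for every `v ∈ T_y N` (the defect is `(dt(df v))²`).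
Beig–Chruściel 1996, §4 ("`|X|_δ ≥ |X|_g`"). [cite: BeigChrusciel1996, §4 (proof of Thm. 4.1)] -/
theorem inducedBilin_self_le_norm_spatial_sq (f : N → E4) (y : N) (v : TangentSpace I' y) :
    smoothMetric.toPseudoRiemannianMetric.inducedBilin I' f y v v ≤
      ‖E4.spatial (mfderiv I' 𝓘(ℝ, E4) f y v)‖ ^ 2 := by
  rw [PseudoRiemannianMetric.inducedBilin_apply]
  show bilin (mfderiv I' 𝓘(ℝ, E4) f y v) (mfderiv I' 𝓘(ℝ, E4) f y v) ≤ _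
  rw [bilin_self_eq_norm_spatial_sq_sub]
  nlinarith [sq_nonneg (E4.time (mfderiv I' 𝓘(ℝ, E4) f y v))]

/-- **For a spacelike immersion into Minkowski space-time, `π ∘ df_y` is injective**: a tangent
vector with vanishing spatial projection has `(f^*η)(v, v) ≤ 0`, hence is zero. So the spatial
projection `π ∘ f` is an immersion (`dim N = 3`), expanding for the induced metric.
[cite: BeigChrusciel1996, §4 (proof of Thm. 4.1)] -/
theorem injective_spatial_comp_mfderiv {f : N → E4}
    (hfi : smoothMetric.toPseudoRiemannianMetric.IsSpacelikeImmersion I' f) (y : N) :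
    Injective ((E4.spatial : E4 →L[ℝ] E3).comp (mfderiv I' 𝓘(ℝ, E4) f y)) := by
  refine (injective_iff_map_eq_zero _).2 fun v hv ↦ ?_
  by_contra h
  have hpos := hfi.2 y v h
  have hle := inducedBilin_self_le_norm_spatial_sq (I' := I') f y v
  have hv' : E4.spatial (mfderiv I' 𝓘(ℝ, E4) f y v) = 0 := hv
  rw [hv', norm_zero] at hle
  nlinarith

end Minkowski

end Literature.Geometry.Lorentzian

end
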